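import Literature.MathematicalPhysics.QuantumFieldTheory.Balaban1983to89.Node00.CriticalOnFibreTopGuardedB
import Literature.MathematicalPhysics.QuantumFieldTheory.Balaban1983to89.Node00.Record12BgRowMixedDataB

/-!
# NODE 00 — THE TWO PRINT PLUGS OF F0c's STEP TOKENS: `dataSmall7LamTopOf F N : TopData F N` (print's (7) data hypothesis under (α), §7′'s `Sect2.DataSmall7LamTop`) and
# `lamPlaqs0Of F : PlaqRange0 F` (print's level-0 exclusion range, §7′'s `Sect2.lamPlaqs Ω k 0`) — P0 of the S1c lane of the (E1)∕(iii-b) work plan (director-ym №338∕№339; FLAG №16;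
# LOCATE-HSEAM 5d3298b8d191f169; node00-def-R COORD-2 ∕ node00-def-Y LANDED-87: «both one-liners are n07-e's pen»), plus the GUARDED data-row transfer for the three tokens

Cell `pub-ymgap`, seat `pub-ymgap-dag-n07-e` g34 (lineage of module 47 `Node00/CriticalOnFibreTopGuarded` and F0c `…TopGuardedB`).  `--kind definition --supports stmt-QuantumFields-20541`
(K0⁷; count-neutral).  PURELY ADDITIVE — two instances of F0c's parameter types at §7′'s print objects (`Node00/Record12BgRowMixedDataB`, node00-def-Y g30 ✓p766157), nothing landed is
edited; HONESTY GUARD (№338 (5), frame verbatim): «print-datum instances for `Node00/CriticalOnFibreTopGuardedB` (FLAG №16 ∕ LOCATE-HSEAM 5d3298b8d191f169); the (b)-instances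
`dataSmall7PTopOf ∕ printedPlaqs0Of` (and module 47's tokens) stay landed and true on their own text»; no displayed premise of any token is deleted or weakened.
[15] = [Balaban1985Variational]; [6] = [Balaban1985RegularSpaces]; [II] = [Balaban1984PropagatorsII]; [III] = [Balaban1988Convergent]; [I] = [Balaban1987RG1].

WHY.  F0c made the data row of [15] Prop. 8's step token a parameter `Dat : TopData F N` and the core form's level-0 plaquette exclusion a parameter `Ex0 : PlaqRange0 F`, with the
(b)-reading instances `dataSmall7PTopOf F N` ∕ `printedPlaqs0Of F`.  Under ruling (α) of record — [II] (2.3) «Λ_j = Ω_j^{(j)} ∖ Ω_{j+1}^{(j)} … for the sets of sites and the sets of bonds»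
(p. 224; the DIFFERENCE of the bond sets: an inward connector belongs to no `Λ_j`) — print's (7) «|(∂V)(p′) − 1| < ε₁ for p′ ∈ 𝔅_k» ([15] p. 278 L20–33) is defined exactly on the
`Λ_j`-plaquettes with NO corner in `Ω_{j+1}^{(j)}` (§7′'s `Sect2.lamPlaqs`), and the level-0 plaquettes the core form may leave to the data are those «⊂ Λ₀» (`Sect2.lamPlaqs Ω k 0`; the
one-deep-corner plaquettes of `Sect2.printedPlaqs Ω k 0` carry two free connector variables under (2.3) and must be halved by the conclusion — node00-def-Y INTENT-87 advice, node00-def-R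
COORD-1 (A2), two independent reads).  This file NAMES the two print instances so that the S1 twins and V23 can key on them, and records (i) that print's instances are the SMALLER range ∕
the WEAKER data hypothesis (`lamPlaqs0Of ⊆ printedPlaqs0Of` for `1 ≤ k`; `dataSmall7PTopOf → dataSmall7LamTopOf` for an index with `Ω_{k+1} = ∅` and saturated regions in the standing range —
§7′'s `Sect2.DataSmall7PTop.toLamTop`), (ii) the GUARDED form of F0c's `.of_imp_dat` (the implication may use the run's prefix `ν M g K k s`, the guard `Adm` and `1 ≤ k` — which is what
the transfer (i) needs at the record, where `s.Ω (k+1) = ∅` is `Seq.Ω_off` and saturation comes from the grid numerics of the guard).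

WHAT IS HERE (sorry-free; TWO definitions + bookkeeping).
* §1 `dataSmall7LamTopOf F N : TopData F N`, `lamPlaqs0Of F : PlaqRange0 F`; `…_apply` unfoldings; `lamPlaqs0Of_subset_printedPlaqs0Of` (`1 ≤ k`); ★ `dataSmall7LamTopOf_of_dataSmall7PTopOf`
  (§7′'s `toLamTop`, hypotheses displayed: `k ≤ m + K`, `Ω (k+1) = ∅`, block saturation); `dataSmall7LamTopOf_of_seq` (the same at a (2.18) index `s : SeqOfRecord F ν M g K k`, where
  `Ω (k+1) = ∅` is `s.Ω_off` — saturation stays displayed).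
* §2 ★ `Prop8RegSepTopStepGB.of_imp_dat_adm ∕ HalvingStepTopGB.of_imp_dat_adm ∕ HalvingStepTopCoreGB.of_imp_dat_adm` — antitone in the data predicate UNDER THE GUARD (the pointwise
  implication `Dat′ → Dat` may depend on `ν M g K k s`, `Adm ν M g K k s`, `1 ≤ k`); `HalvingStepTopCoreGB.toPrintedPlaqs0_of_lamPlaqs0` (a core token excluding only print's level-0 range
  serves the one excluding module 47's, `.of_subset_ex0` + §1).
NOT HERE: any record-level corollary needing Summits-side saturation lemmas (`blockSat_seqOfRecord`) — one line at the consumer; the S1 twins; V23's texts.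
HONEST SCOPE.  Definitions (instances of parameter types) + bookkeeping; nothing of [15]∕[6]∕[II]∕[III] asserted or proved; no (b)-instance claimed false; K0⁷ stub 1 NOT closed; N07 NOT
discharged; counts unmoved (typed 28∕28 · discharged 8∕28); one finite 𝕋⁴ programme at fixed ε — nothing continuum ∕ ℝ⁴ ∕ OS ∕ mass gap ∕ Clay.  No `sorry`, no `instance`, no `notation`.

References: [15] (3),(7) p.278 L20–33, (144) p.300, Prop. 8 p.304, Sect. F pp.300–304; [6] (1.3)–(1.9) p.77; [II] (2.3) p.224 L10–16; [III] (2.1)–(2.2) pp.254–255, (2.10)–(2.12) p.256,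
(2.18) p.257; [I] (0.1) p.251.
-/

noncomputable section

namespace Literature.MathematicalPhysics.QuantumFieldTheory.Balaban1983to89.Node00

open scoped Matrix.Norms.L2Operator
open T4Continuum (T4Family)
open B5Eq118OneStroke (iterBlockOf)
open B15DeterminingSets B15DeterminingSetsB

/-! ## §1  The two print instances -/

section PrintPlugs

variable (F : T4Family) (N : ℕ) [NeZero N]

/-- **PRINT'S (7) DATA HYPOTHESIS FOR THE TOP DOMAIN, AS A `TopData`** — §7′'s `Sect2.DataSmall7LamTop (avOfRecord F N K) Ω Ω₀ k δ W` (level 0: `W 0` on the `Λ₀`-plaquettes meeting `Ω₀`;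
level `m+1 ≤ k`: the (7) field spliced along `Λ_{m+1}`'s bonds on print's `Λ_{m+1}`-plaquettes), same arity ∕ order as `dataSmall7PTopOf`; the print plug of F0c's `Dat` binder under
ruling (α) (node00-def-R COORD-2). [cite: Balaban1985Variational, (3),(7) p.278 L20–33; Balaban1984PropagatorsII, (2.3) p.224; Balaban1985RegularSpaces, (1.3)–(1.9) p.77] -/
def dataSmall7LamTopOf : TopData F N := fun K Ω Ω₀ k δ W => Sect2.DataSmall7LamTop (avOfRecord F N K) Ω Ω₀ k δ W

variable {N} in
/-- **PRINT'S LEVEL-0 EXCLUSION RANGE, AS A `PlaqRange0`** — §7′'s `Sect2.lamPlaqs Ω k 0` (the level-0 plaquettes «⊂ Λ₀ = Ω₁ᶜ», [15] p. 278: all four bonds `Λ₀`-bonds, so data +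
agreement pin them); the one-deep-corner plaquettes of module 47's `Sect2.printedPlaqs Ω k 0` are NOT excluded (their two connector bonds are free under (2.3)); the print plug of F0c's `Ex0`
binder (node00-def-Y INTENT-87 ∕ node00-def-R COORD-1 (A2)). [cite: Balaban1985Variational, (7) p.278 L20–33, Sect. F p.304; Balaban1984PropagatorsII, (2.3) p.224] -/
def lamPlaqs0Of : PlaqRange0 F := fun _ k Ω => Sect2.lamPlaqs Ω k 0

variable {F N}

/-- Unfolding of `dataSmall7LamTopOf`. [cite: Balaban1985Variational, (7) p.278 (bookkeeping)] -/
theorem dataSmall7LamTopOf_apply (K : ℕ) (Ω : ℕ → Set (Site (F.P K) 0)) (Ω₀ : Set (Site (F.P K) 0)) (k : ℕ) (δ : ℕ → ℝ) (W : MSField (F.P K) (SU N)) :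
    dataSmall7LamTopOf F N K Ω Ω₀ k δ W ↔ Sect2.DataSmall7LamTop (avOfRecord F N K) Ω Ω₀ k δ W := Iff.rfl

/-- Unfolding of `lamPlaqs0Of`. [cite: Balaban1985Variational, (7) p.278 (bookkeeping)] -/
theorem lamPlaqs0Of_apply (K k : ℕ) (Ω : ℕ → Set (Site (F.P K) 0)) : lamPlaqs0Of F K k Ω = Sect2.lamPlaqs Ω k 0 := rfl

/-- Print's level-0 exclusion range is contained in module 47's (`1 ≤ k`: §7′'s `Sect2.lamPlaqs_subset_printedPlaqs_of_lt`). [cite: Balaban1985Variational, (7) p.278 (bookkeeping)] -/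
theorem lamPlaqs0Of_subset_printedPlaqs0Of (K : ℕ) {k : ℕ} (hk : 1 ≤ k) (Ω : ℕ → Set (Site (F.P K) 0)) : lamPlaqs0Of F K k Ω ⊆ printedPlaqs0Of F K k Ω :=
  Sect2.lamPlaqs_subset_printedPlaqs_of_lt Ω k hk

/-- ★ **THE RECORD'S TOP-DOMAIN (7) GIVES PRINT'S**, as `TopData` instances — §7′'s `Sect2.DataSmall7PTop.toLamTop` (hypotheses displayed: standing range `k ≤ m + K`, `Ω (k+1) = ∅`, block
saturation of the regions `Ω_j`, `1 ≤ j ≤ k`). [cite: Balaban1985Variational, (3),(7) p.278 L20–33; Balaban1984PropagatorsII, (2.3) p.224] -/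
theorem dataSmall7LamTopOf_of_dataSmall7PTopOf {K : ℕ} {Ω : ℕ → Set (Site (F.P K) 0)} {Ω₀ : Set (Site (F.P K) 0)} {k : ℕ} (hk : k ≤ (F.P K).m + (F.P K).K) (hΩ : Ω (k + 1) = ∅)
    (hsat : ∀ (j : ℕ) (x x' : Site (F.P K) 0), 1 ≤ j → j ≤ k → iterBlockOf j x = iterBlockOf j x' → x ∈ Ω j → x' ∈ Ω j) {δ : ℕ → ℝ} {W : MSField (F.P K) (SU N)}
    (h : dataSmall7PTopOf F N K Ω Ω₀ k δ W) : dataSmall7LamTopOf F N K Ω Ω₀ k δ W :=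
  Sect2.DataSmall7PTop.toLamTop hk hΩ hsat h

/-- The same at a (2.18) index of record `s : SeqOfRecord F ν M g K k`: `s.Ω (k+1) = ∅` is `Seq.Ω_off`; saturation of `s.Ω j` stays displayed (at the record it is the grid numerics of the
guard, Summits-side `blockSat_seqOfRecord`). [cite: Balaban1988Convergent, (2.1) p.254, (2.18) p.257; Balaban1985Variational, (7) p.278] -/
theorem dataSmall7LamTopOf_of_seq {ν : Stage7Numerics} {M : ℕ} {g : ℕ → ℝ} {K k : ℕ} (s : SeqOfRecord F ν M g K k) (hk : k ≤ (F.P K).m + (F.P K).K)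
    (hsat : ∀ (j : ℕ) (x x' : Site (F.P K) 0), 1 ≤ j → j ≤ k → iterBlockOf j x = iterBlockOf j x' → x ∈ s.Ω j → x' ∈ s.Ω j) {Ω₀ : Set (Site (F.P K) 0)} {δ : ℕ → ℝ}
    {W : MSField (F.P K) (SU N)} (h : dataSmall7PTopOf F N K s.Ω Ω₀ k δ W) : dataSmall7LamTopOf F N K s.Ω Ω₀ k δ W :=
  dataSmall7LamTopOf_of_dataSmall7PTopOf hk (s.Ω_off (k + 1) (by omega)) hsat h

end PrintPlugs

/-! ## §2  Antitone in the data predicate UNDER THE GUARD; the core token across the two exclusion ranges -/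

section GuardedTransfer

variable {F : T4Family} {N : ℕ} [NeZero N]

/-- ★ GUARDED `.of_imp_dat` for `Prop8RegSepTopStepGB`: a data hypothesis `Dat′` implying `Dat` AT THE RUN'S PREFIX (the implication may use `ν M g K k s`, the guard and `1 ≤ k`) gives the
token at `Dat′` from the token at `Dat`. [cite: Balaban1985Variational, (7) p.278, Prop. 8 p.304 (bookkeeping)] -/
theorem Prop8RegSepTopStepGB.of_imp_dat_adm {Sup : (ν : Stage7Numerics) → (K : ℕ) → (ℕ → Set (Site (F.P K) 0)) → Set (Site (F.P K) 0)} {Adm : StepGuard F} {bd : BondDatum F}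
    {Dat Dat' : TopData F N} {B₃ a₀ a₁ : ℝ} (h : Prop8RegSepTopStepGB F N Sup Adm bd Dat B₃ a₀ a₁)
    (himp : ∀ (ν : Stage7Numerics) (M : ℕ) (g : ℕ → ℝ) (K k : ℕ) (s : SeqOfRecord F ν M g K k), Adm ν M g K k s → 1 ≤ k →
      ∀ (δ : ℕ → ℝ) (W : MSField (F.P K) (SU N)), Dat' K s.Ω (Sup ν K s.Ω) k δ W → Dat K s.Ω (Sup ν K s.Ω) k δ W) :
    Prop8RegSepTopStepGB F N Sup Adm bd Dat' B₃ a₀ a₁ :=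
  fun ν M g K k s hsep hM₁ hadm hk ε₀ δ hδ hcomp hcomp' hε₀ W h7 => h ν M g K k s hsep hM₁ hadm hk ε₀ δ hδ hcomp hcomp' hε₀ W (himp ν M g K k s hadm hk δ W h7)

/-- ★ GUARDED `.of_imp_dat` for `HalvingStepTopGB`. [cite: Balaban1985Variational, (7) p.278, Sect. F p.304 (bookkeeping)] -/
theorem HalvingStepTopGB.of_imp_dat_adm {Sup : (ν : Stage7Numerics) → (K : ℕ) → (ℕ → Set (Site (F.P K) 0)) → Set (Site (F.P K) 0)} {Adm : StepGuard F} {bd : BondDatum F}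
    {Dat Dat' : TopData F N} {B₃ a₀ a₁ : ℝ} (h : HalvingStepTopGB F N Sup Adm bd Dat B₃ a₀ a₁)
    (himp : ∀ (ν : Stage7Numerics) (M : ℕ) (g : ℕ → ℝ) (K k : ℕ) (s : SeqOfRecord F ν M g K k), Adm ν M g K k s → 1 ≤ k →
      ∀ (δ : ℕ → ℝ) (W : MSField (F.P K) (SU N)), Dat' K s.Ω (Sup ν K s.Ω) k δ W → Dat K s.Ω (Sup ν K s.Ω) k δ W) :
    HalvingStepTopGB F N Sup Adm bd Dat' B₃ a₀ a₁ :=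
  fun ν M g K k s hsep hM₁ hadm hk ε δ hδ hcomp hcomp' hε hεcomp hεcomp' W h7 =>
    h ν M g K k s hsep hM₁ hadm hk ε δ hδ hcomp hcomp' hε hεcomp hεcomp' W (himp ν M g K k s hadm hk δ W h7)

/-- ★ GUARDED `.of_imp_dat` for `HalvingStepTopCoreGB`. [cite: Balaban1985Variational, (7) p.278, Sect. F p.304 (bookkeeping)] -/
theorem HalvingStepTopCoreGB.of_imp_dat_adm {Sup : (ν : Stage7Numerics) → (K : ℕ) → (ℕ → Set (Site (F.P K) 0)) → Set (Site (F.P K) 0)} {Adm : StepGuard F} {bd : BondDatum F}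
    {Dat Dat' : TopData F N} {Ex0 : PlaqRange0 F} {B₃ a₀ a₁ : ℝ} (h : HalvingStepTopCoreGB F N Sup Adm bd Dat Ex0 B₃ a₀ a₁)
    (himp : ∀ (ν : Stage7Numerics) (M : ℕ) (g : ℕ → ℝ) (K k : ℕ) (s : SeqOfRecord F ν M g K k), Adm ν M g K k s → 1 ≤ k →
      ∀ (δ : ℕ → ℝ) (W : MSField (F.P K) (SU N)), Dat' K s.Ω (Sup ν K s.Ω) k δ W → Dat K s.Ω (Sup ν K s.Ω) k δ W) :
    HalvingStepTopCoreGB F N Sup Adm bd Dat' Ex0 B₃ a₀ a₁ :=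
  fun ν M g K k s hsep hM₁ hadm hk ε δ hδ hcomp hcomp' hε hεcomp hεcomp' W h7 =>
    h ν M g K k s hsep hM₁ hadm hk ε δ hδ hcomp hcomp' hε hεcomp hεcomp' W (himp ν M g K k s hadm hk δ W h7)

/-- A core token excluding only PRINT's level-0 range serves the one excluding module 47's (`lamPlaqs0Of ⊆ printedPlaqs0Of` under the token's own `1 ≤ k`; F0c's `.of_subset_ex0` needs the
inclusion for every `k`, so the transfer is re-threaded here with `1 ≤ k` in hand). [cite: Balaban1985Variational, (7) p.278, Sect. F p.304 (bookkeeping)] -/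
theorem HalvingStepTopCoreGB.toPrintedPlaqs0_of_lamPlaqs0 {Sup : (ν : Stage7Numerics) → (K : ℕ) → (ℕ → Set (Site (F.P K) 0)) → Set (Site (F.P K) 0)} {Adm : StepGuard F}
    {bd : BondDatum F} {Dat : TopData F N} {B₃ a₀ a₁ : ℝ} (h : HalvingStepTopCoreGB F N Sup Adm bd Dat (lamPlaqs0Of F) B₃ a₀ a₁) :
    HalvingStepTopCoreGB F N Sup Adm bd Dat (printedPlaqs0Of F) B₃ a₀ a₁ := by
  intro ν M g K k s hsep hM₁ hadm hk ε δ hδ hcomp hcomp' hε hεcomp hεcomp' W h7 U h17 h19 hfib hcrit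
  obtain ⟨hP, hD⟩ := h ν M g K k s hsep hM₁ hadm hk ε δ hδ hcomp hcomp' hε hεcomp hεcomp' W h7 U h17 h19 hfib hcrit
  exact ⟨fun n hn p hp hpx => hP n hn p hp fun h' => hpx (lamPlaqs0Of_subset_printedPlaqs0Of K hk s.Ω h'), hD⟩

end GuardedTransfer

end Literature.MathematicalPhysics.QuantumFieldTheory.Balaban1983to89.Node00

end
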